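import Summits.BirchSwinnertonDyer.BirchSwinnertonDyer.Theorems.KimAtThreeTwoExponentAssembly
import Summits.BirchSwinnertonDyer.BirchSwinnertonDyer.Theorems.KimAtThreeKolyvaginDefs
import Summits.BirchSwinnertonDyer.BirchSwinnertonDyer.Theorems.KimAtThreeKolyvaginDeepLowerNestedEnd
import HarnessLib

/-!
# Route `KimAtThreeKolyvagin` (W2), cruxes 19599 / 19077: acc6's two-exponent END theorems keyed on the
# UNLOCKED two-depth dictionary — no reduction type at `3`

Cell `bsd-addord`, seat `bsd-addord-w2-c4` (gen 7, owner of 19599); `--supports` 19599.  HONEST FRAMING: TOOL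
theorems only (no definition, no named fact, no `sorry`; nothing asserted or booked; 19599 / 19562 / 19679 / 19077
stay OPEN; BSD is not proved by any of this).  The two theorems of acc6's `KimAtThreeTwoExponentEnd` (p462990;
credit acc6 g0, kim3 g8, n1011-p18/p03/p11; adapted, not edited) with ONE binder re-typed: `hdict` is no longer the
LOCKED predicate `KimAtThreeKolyvaginDefs.KatoKuriharaDictionaryThreeAt₂AtTwoExp` (antecedents `Addv W 3`, surj(3),
`#E(ℚ₃)[3] = 3^t`, `v₃ ∣ 3`, pin of `red` — acc6's row binder `hadd` was used ONLY to feed them) but its UNLOCKED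
conclusion: the witness clauses `KimAtThreeKolyvaginDefs.KatoKuriharaWitnessAtTwoExp` at two depths + (COMP); the
binders `hadd`, `ht` (and in the first theorem `hred`) disappear, so the END applies on EVERY row (good ordinary /
supersingular / multiplicative / additive `3`) once a Kato–Kurihara port of any antecedent shape is unlocked BY ITS
ROW (additive: PORT₂; Kato stratum: PORT″; non-additive `3`: the same clauses, Kim AJM 148 Thm. 3.13 / Lemma 3.3 /
3.8 = definition item `defn-KatoKuriharaDictionaryThreeNonAddAt`, NOT in print at `3`, FLAG `K22-Thm3.13-PORT@3`).
References: [Kim2022StructureSelmer] Thm. 1.9 (6), Thm. 3.13, Lemma 3.3, 3.8; [Kim2025RefinedTNC] Thm 1.1, §4.2;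
[Sakamoto2024] Thm. 4.4; [MazurRubin2004] Thm. 3.2.4, 4.4.1, App. A (33); cell memo kim3/KIM3-PROOF.md §4.4, §16.
-/
set_option autoImplicit false
-- the Theorems namespace of a single-conjunct summit repeats the summit name by design (D-0017)
set_option linter.dupNamespace false

noncomputable section

open scoped Classical NumberField ContRepresentation
open Function Field NumberField IsDedekindDomain IsDedekindDomain.HeightOneSpectrum WeierstrassCurve
  CongruenceSubgroup
  Literature.NumberTheory.EllipticCurves Literature.NumberTheory.EllipticCurves.ModularForms
  Literature.NumberTheory.EllipticCurves.Rank1Residual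
  Literature.NumberTheory.GaloisRepresentations
  Literature.NumberTheory.GaloisRepresentations.DiscreteGaloisModule Literature.NumberTheory.GaloisCohomology
  Rat.HeightOneSpectrum
  Summit.BirchSwinnertonDyer.Rank1Residual.GaloisImage
  Summit.BirchSwinnertonDyer.Rank1Residual.GaloisImage.Assembly
  Summit.BirchSwinnertonDyer.Rank1Residual.X4

namespace Summit.BirchSwinnertonDyer.BirchSwinnertonDyer.Theorems.KimAtThreeShallowEqDeepUnlockedEnd

open Summit.BirchSwinnertonDyer.BirchSwinnertonDyer.Theorems.KimAtThreeKolyvaginDefs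
  Summit.BirchSwinnertonDyer.BirchSwinnertonDyer.Theorems.KimAtThreeTwoExponentAssembly

/-- **(C20) at `p = 3`, TWO-EXPONENT form, `[0]⁺_f`-currency, UNLOCKED dictionary** — twin of n1011's
`Assembly.padicValRat_le_of_certificate_at` (module docstring for the binder diff): from a MINIMAL certificate
`δ̃^{(j)}_n(ψ₀) ≠ 0` at a level `n` of the shallow datum `D` (`t + j ≤ k + 1`),
**`ord₃ [0]⁺_{P.f} ≤ ord₃ #Ш(E/ℚ)(3) + (j − 1)`**; deep level `k′ = max k (X + t + v)`, `v = ord₃ [0]⁺_{P.f}`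
(`LValue.exists_unit_kuriharaNumber_one_eq`), `#Sel_{3^{k′+1}} ∣ #Ш[3^∞]`, two-exponent assembly (`e` cancels).
[cite: Kim2022StructureSelmer, Thm. 1.9 (6) and Thm. 3.13] [cite: Sakamoto2024, Thm. 4.4 (p. 926)]
[cite: MazurRubin2004, Thm. 3.2.4 and App. A (33)] -/
theorem padicValRat_ratPlusSymbol_le_of_certificate_twoExp_unlocked
    (W : WeierstrassCurve ℚ) [W.IsElliptic] [W.IsGloballyMinimal] (t e k : ℕ)
    (D : KolyvaginDatum (W.torsionGaloisModule (((3 : ℕ) : ℤ) ^ k * ((3 : ℕ) : ℤ))))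
    (v₃ : HeightOneSpectrum (𝓞 ℚ)) (hv₃ : ((3 : ℕ) : 𝓞 ℚ) ∈ v₃.asIdeal)
    -- the row
    (hsurj : W.HasSurjectiveModNGaloisRep ((3 : ℕ) : ℤ))
    [Finite W.toAffine.Point] [Finite W.sha]
    {N : ℕ} [NeZero N] (P : ModularParametrizationData W N) (h0 : ratPlusSymbol P.f 0 ≠ 0)
    (g : Finset (HeightOneSpectrum (𝓞 ℚ)) →
      galoisCohomology (W.torsionGaloisModule (((3 : ℕ) : ℤ) ^ k * ((3 : ℕ) : ℤ))) 1)
    (hgen : ∀ κ ∈ D.kolyvaginSystems (propagatedSelmerStructure W 3 k), ∃ a : ℕ, κ = a • g)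
    (D' : ∀ k' : ℕ, KolyvaginDatum (W.torsionGaloisModule (((3 : ℕ) : ℤ) ^ k' * ((3 : ℕ) : ℤ))))
    (red : ∀ k' : ℕ, (W.torsionGaloisModule (((3 : ℕ) : ℤ) ^ k' * ((3 : ℕ) : ℤ))).toContRepresentation
      →ⁱL (W.torsionGaloisModule (((3 : ℕ) : ℤ) ^ k * ((3 : ℕ) : ℤ))).toContRepresentation)
    (hdict : ∀ k', k ≤ k' → ∃ κ Λ κ' κu Λu κu',
        KatoKuriharaWitnessAtTwoExp W k t e D v₃ P κ Λ κ' ∧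
        KatoKuriharaWitnessAtTwoExp W k' t e (D' k') v₃ P κu Λu κu' ∧
        ∀ d, (D' k').IsLevel d → D.IsLevel d →
          galoisCohomology.map (red k') 1 (κu d) = κ d ∧ galoisCohomology.map (red k') 1 (κu' d) = κ' d)
    (g' : ∀ k' : ℕ, Finset (HeightOneSpectrum (𝓞 ℚ)) →
      galoisCohomology (W.torsionGaloisModule (((3 : ℕ) : ℤ) ^ k' * ((3 : ℕ) : ℤ))) 1)
    (hg' : ∀ k', g' k' ∈ (D' k').kolyvaginSystems (propagatedSelmerStructure W 3 k'))
    (hgen' : ∀ k', ∀ κ ∈ (D' k').kolyvaginSystems (propagatedSelmerStructure W 3 k'),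
      ∃ a : ℕ, κ = a • g' k')
    (inv' : ∀ k' : ℕ, LocalInvariants ℚ (3 ^ (k' + 1))) (hperf' : ∀ k', (inv' k').IsPerfect)
    (hsum' : ∀ k', (inv' k').SumLocalTermEqZero) (hcompl' : ∀ k', (inv' k').SelmerComplement)
    (hinj' : ∀ k', ∀ v : HeightOneSpectrum (𝓞 ℚ), Injective (inv' k' (Sum.inr v)))
    (hEP : ∀ v : HeightOneSpectrum (𝓞 ℚ), localEulerPoincareCharacteristic (v.adicCompletion ℚ))
    (T : ∀ k' : ℕ, Finset (HeightOneSpectrum (𝓞 ℚ))) (hv₃T : ∀ k', v₃ ∈ T k')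
    (hT : ∀ k', ∀ v : HeightOneSpectrum (𝓞 ℚ), v ∉ T k' →
      (((3 ^ (k' + 1) : ℕ) : ℕ) : 𝓞 ℚ) ∉ v.asIdeal ∧
        GaloisRep.IsUnramifiedAt v (W.torsionGaloisModule (((3 : ℕ) : ℤ) ^ k' * ((3 : ℕ) : ℤ))))
    (h𝓕T : ∀ k', (propagatedSelmerStructure W 3 k').IsUnramifiedOutside (finSupport (T k')))
    (h𝓚T : ∀ k', (W.kummerSelmerStructure (((3 : ℕ) : ℤ) ^ k' * ((3 : ℕ) : ℤ))).IsUnramifiedOutside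
      (finSupport (T k')))
    (hfinT : ∀ k', Finite (geomTorsion W (((3 : ℕ) : ℤ) ^ k' * ((3 : ℕ) : ℤ))))
    (hfinS : ∀ k', Finite (W.kummerSelmerStructure (((3 : ℕ) : ℤ) ^ k' * ((3 : ℕ) : ℤ))).selmerGroup)
    (hR22 : ∀ k', (Nat.card ((inv' k').dualSelmerStructure
          (W.torsionGaloisModule (((3 : ℕ) : ℤ) ^ k' * ((3 : ℕ) : ℤ)))
          (propagatedSelmerStructure W 3 k')).selmerGroup ∣ 3 ^ (k' + 1) →
        addOrderOf (g' k' ∅) * Nat.card ((inv' k').dualSelmerStructure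
          (W.torsionGaloisModule (((3 : ℕ) : ℤ) ^ k' * ((3 : ℕ) : ℤ)))
            (propagatedSelmerStructure W 3 k')).selmerGroup = 3 ^ (k' + 1)) ∧
      (3 ^ (k' + 1) ∣ Nat.card ((inv' k').dualSelmerStructure
          (W.torsionGaloisModule (((3 : ℕ) : ℤ) ^ k' * ((3 : ℕ) : ℤ)))
            (propagatedSelmerStructure W 3 k')).selmerGroup → g' k' ∅ = 0))
    (hNp : ∀ k', ∃ l, Nat.card ((inv' k').dualSelmerStructure
        (W.torsionGaloisModule (((3 : ℕ) : ℤ) ^ k' * ((3 : ℕ) : ℤ)))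
          (propagatedSelmerStructure W 3 k')).selmerGroup = 3 ^ l)
    (htr : ∀ k', k ≤ k' → ∀ (κ' : Finset (HeightOneSpectrum (𝓞 ℚ)) →
        galoisCohomology (W.torsionGaloisModule (((3 : ℕ) : ℤ) ^ k * ((3 : ℕ) : ℤ))) 1)
      (κu' : Finset (HeightOneSpectrum (𝓞 ℚ)) →
        galoisCohomology (W.torsionGaloisModule (((3 : ℕ) : ℤ) ^ k' * ((3 : ℕ) : ℤ))) 1)
      (a a' : ℕ), κ' ∈ D.kolyvaginSystems (propagatedSelmerStructure W 3 k) →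
        κu' ∈ (D' k').kolyvaginSystems (propagatedSelmerStructure W 3 k') →
        κ' = a • g → κu' = a' • g' k' →
        (∀ d, (D' k').IsLevel d → D.IsLevel d → galoisCohomology.map (red k') 1 (κu' d) = κ' d) →
        ∀ s, s ≤ k + 1 → (3 ^ s ∣ a ↔ 3 ^ s ∣ a'))
    -- the certificate at a level `n` of `D`
    (n : Finset (HeightOneSpectrum (𝓞 ℚ))) (hn : D.IsLevel n) {j : ℕ} (htj : t + j ≤ k + 1)
    (hPN : ∀ q ∈ n, (Ideal.absNorm q.asIdeal).Coprime N)
    {ψ₀ : (ℓ : ℕ) → (ZMod ℓ)ˣ →* Multiplicative (ZMod (3 ^ j))}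
    (hψ₀ : ∀ q ∈ n, Function.Surjective (ψ₀ (Ideal.absNorm q.asIdeal)))
    (hcert : haveI : NeZero (∏ q ∈ n, Ideal.absNorm q.asIdeal) :=
        ⟨Finset.prod_ne_zero_iff.2 fun q _ => absNorm_ne_zero q⟩
      kuriharaNumber P.f (3 ^ j) (∏ q ∈ n, Ideal.absNorm q.asIdeal) ψ₀ ≠ 0)
    (hv : ∀ c, c ⊂ n → c.Nonempty → ∀ ψ' : (ℓ : ℕ) → (ZMod ℓ)ˣ →* Multiplicative (ZMod (3 ^ j)),
      (∀ q ∈ c, Function.Surjective (ψ' (Ideal.absNorm q.asIdeal))) →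
        haveI : NeZero (∏ q ∈ c, Ideal.absNorm q.asIdeal) :=
          ⟨Finset.prod_ne_zero_iff.2 fun q _ => absNorm_ne_zero q⟩
        kuriharaNumber P.f (3 ^ j) (∏ q ∈ c, Ideal.absNorm q.asIdeal) ψ' = 0) :
    padicValRat 3 (ratPlusSymbol P.f 0) ≤
      (padicValNat 3 (Nat.card (AddCommGroup.primaryComponent W.sha 3)) : ℤ) + ((j - 1 : ℕ) : ℤ) := by
  haveI : Fact (Nat.Prime 3) := ⟨Nat.prime_three⟩
  haveI : NeZero ((3 : ℕ) : ℚ) := ⟨by norm_num⟩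
  have hirr : W.HasIrreducibleModPGaloisRep 3 :=
    hasIrreducibleModPGaloisRep_of_hasSurjectiveModNGaloisRep W 3 hsurj
  -- the `L`-value witness on `[0]⁺_{P.f}` itself: `3`-integral, `ord₃ = v`, `δ̃_1 = 3^v · unit` at every modulus
  have hint : ¬ 3 ∣ (ratPlusSymbol P.f 0).den :=
    not_dvd_den_of_norm_ratCast_le_one
      (P.isNewformOf.norm_ratPlusSymbol_le_one (x := 0) (by norm_num) hirr (by simp))
  have hv0 : 0 ≤ padicValRat 3 (ratPlusSymbol P.f 0) := by
    rw [padicValRat, padicValNat.eq_zero_of_not_dvd hint]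
    simp
  set v : ℕ := (padicValRat 3 (ratPlusSymbol P.f 0)).toNat with hvdef
  have hvq : padicValRat 3 (ratPlusSymbol P.f 0) = v := by rw [hvdef, Int.toNat_of_nonneg hv0]
  have hKur : ∀ K : ℕ, ∃ w₀ : (ZMod (3 ^ K))ˣ,
      ∀ ψ : (ℓ : ℕ) → (ZMod ℓ)ˣ →* Multiplicative (ZMod (3 ^ K)),
        kuriharaNumber P.f (3 ^ K) 1 ψ = ((3 ^ v : ℕ) : ZMod (3 ^ K)) * (w₀ : ZMod (3 ^ K)) := fun K =>
    LValue.exists_unit_kuriharaNumber_one_eq P.f K h0 hint hvq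
  rw [hvq]
  -- `#Ш[3^∞] = 3^X`
  set X := padicValNat 3 (Nat.card W.sha) with hXdef
  have hSha : Nat.card (AddCommGroup.primaryComponent W.sha 3) = 3 ^ X :=
    natCard_primaryComponent_eq_pow_padicValNat 3
  rw [hSha, padicValNat.prime_pow]
  -- trivial when `v < j`
  rcases Nat.lt_or_ge v j with hvj | hjv
  · have : (v : ℤ) ≤ ((j - 1 : ℕ) : ℤ) := by exact_mod_cast (by omega : v ≤ j - 1)
    have hX0 : (0 : ℤ) ≤ (X : ℤ) := by positivity
    linarith
  -- the deep level
  set k' := max k (X + t + v) with hk'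
  have hkk' : k ≤ k' := le_max_left _ _
  have hK : X + t + v < k' + 1 := Nat.lt_succ_of_le (le_max_right _ _)
  haveI := hfinT k'
  haveI := hfinS k'
  obtain ⟨hSdvd, hSkill⟩ := SelmerSha.card_dvd_and_nsmul_eq_zero W 3 hirr k'
  rw [hSha] at hSdvd hSkill
  -- the `3`-integrality of the symbols at the sub-levels of `n`
  have hden : ∀ d ⊆ n, ∀ a : ℕ,
      (ratPlusSymbol P.f ((a : ℚ) / (∏ q ∈ d, Ideal.absNorm q.asIdeal : ℕ))).den.Coprime
        (3 ^ (k + 1)) := by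
    intro d hd a
    refine LValue.coprime_den_ratPlusSymbol_of_coprime W 3 (by norm_num) hirr P ?_ (k + 1) a
    exact Nat.Coprime.prod_left fun q hq => hPN q (hd hq)
  -- hypothesis (v) at every proper sub-level, the empty one from `v ≥ j`
  have hv' : ∀ c, c ⊂ n → ∀ ψ' : (ℓ : ℕ) → (ZMod ℓ)ˣ →* Multiplicative (ZMod (3 ^ j)),
      (∀ q ∈ c, Function.Surjective (ψ' (Ideal.absNorm q.asIdeal))) →
        haveI : NeZero (∏ q ∈ c, Ideal.absNorm q.asIdeal) :=
          ⟨Finset.prod_ne_zero_iff.2 fun q _ => absNorm_ne_zero q⟩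
        kuriharaNumber P.f (3 ^ j) (∏ q ∈ c, Ideal.absNorm q.asIdeal) ψ' = 0 := by
    intro c hc ψ' hψ'
    rcases c.eq_empty_or_nonempty with rfl | hne
    · -- `δ̃_1^{(j)} = 3^v · unit = 0` in `ℤ/3^j` since `v ≥ j`
      obtain ⟨w₀, hw₀⟩ := hKur j
      have h1 : kuriharaNumber P.f (3 ^ j) 1 ψ' = 0 := by
        rw [hw₀ ψ', show ((3 ^ v : ℕ) : ZMod (3 ^ j)) = 0 from
          (ZMod.natCast_eq_zero_iff _ _).2 (Nat.pow_dvd_pow 3 hjv), zero_mul]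
      simpa using h1
    · exact hv c hc hne ψ' hψ'
  -- unpack the two-exponent dictionary at `(k, k′)`
  obtain ⟨κ, Λ, κ', κu, Λu, κu', hWk, hWk', hcomp⟩ := hdict k' hkk'
  obtain ⟨-, ⟨hKS, hbr⟩, -, -, hdictk⟩ := hWk
  obtain ⟨-, ⟨hKS', hbr'⟩, hon', hker', hdictk'⟩ := hWk'
  have hbr₀' : κu' ∅ = κu ∅ := by
    have h := hbr' ∅ (D' k').isLevel_empty
    have hbot : AddSubgroup.closure
        {x : galoisCohomology (W.torsionGaloisModule (((3 : ℕ) : ℤ) ^ k' * ((3 : ℕ) : ℤ))) 1 |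
          ∃ c, c ⊂ (∅ : Finset (HeightOneSpectrum (𝓞 ℚ))) ∧ x = κu c} = ⊥ := by
      rw [AddSubgroup.closure_eq_bot_iff]
      rintro x ⟨c, hc, -⟩
      exact absurd hc (Finset.not_ssubset_empty c)
    rw [hbot, AddSubgroup.mem_bot, sub_eq_zero] at h
    exact h
  have hdict₀' : ∃ (u : (ZMod (3 ^ (k' + 1)))ˣ)
      (ψ : (ℓ : ℕ) → (ZMod ℓ)ˣ →* Multiplicative (ZMod (3 ^ (k' + 1)))),
      ((3 ^ e : ℕ) : ZMod (3 ^ (k' + 1))) *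
          Λu (galoisCohomology.localization _ (Sum.inr v₃) 1 (κu ∅)) =
        (u : ZMod (3 ^ (k' + 1))) * (3 : ZMod (3 ^ (k' + 1))) ^ t *
          kuriharaNumber P.f (3 ^ (k' + 1)) 1 ψ := by
    obtain ⟨u0, ψ0, -, hL0⟩ := hdictk' ∅ (D' k').isLevel_empty
    exact ⟨u0, ψ0, by simpa using hL0⟩
  -- the two-exponent ASSEMBLY at depth `k′`
  have hmain := pow_dvd_natCard_selmerGroup_of_certificate_twoExp W t e k k' D (D' k') (red k') v₃ hv₃ P
    κ Λ κ' hKS hbr hdictk κu Λu κu' hKS' hbr₀' hon' hker' hdict₀' (fun d hd' hd => (hcomp d hd' hd).2)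
    g hgen (g' k') (hg' k') (hgen' k') (inv' k') (hperf' k') (hsum' k') (hcompl' k') (hinj' k') hEP (T k')
    (hv₃T k') (hT k') (h𝓕T k') (h𝓚T k') (hR22 k') (hNp k') (htr k' hkk') n hn htj hden hψ₀ hcert hv'
    (hKur (k' + 1)) hSkill hK
  -- `3^{v+1−j} ∣ #Sel ∣ 3^X`
  have h := (Nat.pow_dvd_pow_iff_le_right (by norm_num : 1 < 3)).1 (hmain.trans hSdvd)
  have : (v : ℤ) ≤ (X : ℤ) + ((j - 1 : ℕ) : ℤ) := by
    have h' : v + 1 - j ≤ X := h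
    push_cast [Nat.sub_le_iff_le_add] at h' ⊢
    omega
  exact this

/-- **The two-exponent END theorem with transport and level counts discharged, UNLOCKED dictionary** — twin of kim3's
`KimAtThreeKolyvaginDeepLowerNestedEnd.padicValRat_le_of_certificate_of_transport_nested_at` (binder diff in the
module docstring; p11's scalar transport `Transport.pow_dvd_iff_of_comp`, level counts from the `Λ`-clauses,
`hR22`/`hNp` bookkeeping verbatim), ending in `padicValRat_ratPlusSymbol_le_of_certificate_twoExp`.
[cite: Kim2022StructureSelmer, Thm. 1.9 (6) and Thm. 3.13] [cite: Sakamoto2024, Thm. 4.4 (p. 926)]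
[cite: MazurRubin2004, Thm. 3.2.4, Thm. 4.4.1 and App. A (33)] -/
theorem padicValRat_ratPlusSymbol_le_of_certificate_of_transport_nested_twoExp_unlocked
    (W : WeierstrassCurve ℚ) [W.IsElliptic] [W.IsGloballyMinimal] (t e k : ℕ)
    (D : KolyvaginDatum (W.torsionGaloisModule (((3 : ℕ) : ℤ) ^ k * ((3 : ℕ) : ℤ))))
    (v₃ : HeightOneSpectrum (𝓞 ℚ)) (hv₃ : ((3 : ℕ) : 𝓞 ℚ) ∈ v₃.asIdeal)
    -- the row
    (hsurj : W.HasSurjectiveModNGaloisRep ((3 : ℕ) : ℤ))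
    [Finite W.toAffine.Point] [Finite W.sha]
    {N : ℕ} [NeZero N] (P : ModularParametrizationData W N) (h0 : ratPlusSymbol P.f 0 ≠ 0)
    (hDT : D.transverse = cyclotomicTransverse _)
    (g : Finset (HeightOneSpectrum (𝓞 ℚ)) →
      galoisCohomology (W.torsionGaloisModule (((3 : ℕ) : ℤ) ^ k * ((3 : ℕ) : ℤ))) 1)
    (hg : g ∈ D.kolyvaginSystems (propagatedSelmerStructure W 3 k))
    (hgen : ∀ κ ∈ D.kolyvaginSystems (propagatedSelmerStructure W 3 k), ∃ a : ℕ, κ = a • g)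
    -- the deep inputs, at every depth `k′`
    (D' : ∀ k' : ℕ, KolyvaginDatum (W.torsionGaloisModule (((3 : ℕ) : ℤ) ^ k' * ((3 : ℕ) : ℤ))))
    (hDT' : ∀ k', (D' k').transverse = cyclotomicTransverse _)
    (hPP' : ∀ k', k ≤ k' → (D' k').primes ⊆ D.primes)
    (red : ∀ k' : ℕ, (W.torsionGaloisModule (((3 : ℕ) : ℤ) ^ k' * ((3 : ℕ) : ℤ))).toContRepresentation
      →ⁱL (W.torsionGaloisModule (((3 : ℕ) : ℤ) ^ k * ((3 : ℕ) : ℤ))).toContRepresentation)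
    (hred : ∀ k', ∀ x : geomTorsion W (((3 : ℕ) : ℤ) ^ k' * ((3 : ℕ) : ℤ)),
      ((red k' x : geomTorsion W (((3 : ℕ) : ℤ) ^ k * ((3 : ℕ) : ℤ))) : geomPoints W) =
        (((3 : ℕ) : ℤ) ^ (k' - k)) • (x : geomPoints W))
    (hdict : ∀ k', k ≤ k' → ∃ κ Λ κ' κu Λu κu',
        KatoKuriharaWitnessAtTwoExp W k t e D v₃ P κ Λ κ' ∧
        KatoKuriharaWitnessAtTwoExp W k' t e (D' k') v₃ P κu Λu κu' ∧
        ∀ d, (D' k').IsLevel d → D.IsLevel d →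
          galoisCohomology.map (red k') 1 (κu d) = κ d ∧ galoisCohomology.map (red k') 1 (κu' d) = κ' d)
    (g' : ∀ k' : ℕ, Finset (HeightOneSpectrum (𝓞 ℚ)) →
      galoisCohomology (W.torsionGaloisModule (((3 : ℕ) : ℤ) ^ k' * ((3 : ℕ) : ℤ))) 1)
    (hg' : ∀ k', g' k' ∈ (D' k').kolyvaginSystems (propagatedSelmerStructure W 3 k'))
    (hgo' : ∀ k', addOrderOf (g' k') = 3 ^ (k' + 1))
    (hgen' : ∀ k', ∀ κ ∈ (D' k').kolyvaginSystems (propagatedSelmerStructure W 3 k'),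
      ∃ a : ℕ, κ = a • g' k')
    (inv' : ∀ k' : ℕ, LocalInvariants ℚ (3 ^ (k' + 1))) (hperf' : ∀ k', (inv' k').IsPerfect)
    (hsum' : ∀ k', (inv' k').SumLocalTermEqZero) (hcompl' : ∀ k', (inv' k').SelmerComplement)
    (hinj' : ∀ k', ∀ v : HeightOneSpectrum (𝓞 ℚ), Injective (inv' k' (Sum.inr v)))
    (hEP : ∀ v : HeightOneSpectrum (𝓞 ℚ), localEulerPoincareCharacteristic (v.adicCompletion ℚ))
    (T : ∀ k' : ℕ, Finset (HeightOneSpectrum (𝓞 ℚ))) (hv₃T : ∀ k', v₃ ∈ T k')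
    (hT : ∀ k', ∀ v : HeightOneSpectrum (𝓞 ℚ), v ∉ T k' →
      (((3 ^ (k' + 1) : ℕ) : ℕ) : 𝓞 ℚ) ∉ v.asIdeal ∧
        GaloisRep.IsUnramifiedAt v (W.torsionGaloisModule (((3 : ℕ) : ℤ) ^ k' * ((3 : ℕ) : ℤ))))
    (h𝓕T : ∀ k', (propagatedSelmerStructure W 3 k').IsUnramifiedOutside (finSupport (T k')))
    (h𝓚T : ∀ k', (W.kummerSelmerStructure (((3 : ℕ) : ℤ) ^ k' * ((3 : ℕ) : ℤ))).IsUnramifiedOutside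
      (finSupport (T k')))
    (hfinT : ∀ k', Finite (geomTorsion W (((3 : ℕ) : ℤ) ^ k' * ((3 : ℕ) : ℤ))))
    (hfinS : ∀ k', Finite (W.kummerSelmerStructure (((3 : ℕ) : ℤ) ^ k' * ((3 : ℕ) : ℤ))).selmerGroup)
    (hPS : ∀ q ∈ D.primes, q ∉ T k) (hPS' : ∀ k', ∀ q ∈ (D' k').primes, q ∉ T k')
    (hUT : ∀ q ∈ D.primes,
      Nat.card (unramifiedSubgroup (GaloisRep.toLocal q
        (W.torsionGaloisModule (((3 : ℕ) : ℤ) ^ k * ((3 : ℕ) : ℤ)))) 1) =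
        Nat.card (D.transverse (Sum.inr q)))
    (hUT' : ∀ k', ∀ q ∈ (D' k').primes,
      Nat.card (unramifiedSubgroup (GaloisRep.toLocal q
        (W.torsionGaloisModule (((3 : ℕ) : ℤ) ^ k' * ((3 : ℕ) : ℤ)))) 1) =
        Nat.card ((D' k').transverse (Sum.inr q)))
    (hR22D : ∀ d, D.IsLevel d →
      (Nat.card ((inv' k).dualSelmerStructure _
          (D.atLevel (propagatedSelmerStructure W 3 k) d)).selmerGroup ∣ 3 ^ (k + 1) →
        addOrderOf (g d) * Nat.card ((inv' k).dualSelmerStructure _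
          (D.atLevel (propagatedSelmerStructure W 3 k) d)).selmerGroup = 3 ^ (k + 1)) ∧
      (3 ^ (k + 1) ∣ Nat.card ((inv' k).dualSelmerStructure _
          (D.atLevel (propagatedSelmerStructure W 3 k) d)).selmerGroup → g d = 0))
    (hR22' : ∀ k' d, (D' k').IsLevel d →
      (Nat.card ((inv' k').dualSelmerStructure _
          ((D' k').atLevel (propagatedSelmerStructure W 3 k') d)).selmerGroup ∣ 3 ^ (k' + 1) →
        addOrderOf (g' k' d) * Nat.card ((inv' k').dualSelmerStructure _
          ((D' k').atLevel (propagatedSelmerStructure W 3 k') d)).selmerGroup = 3 ^ (k' + 1)) ∧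
      (3 ^ (k' + 1) ∣ Nat.card ((inv' k').dualSelmerStructure _
          ((D' k').atLevel (propagatedSelmerStructure W 3 k') d)).selmerGroup → g' k' d = 0))
    -- the certificate at a level `n` of `D`
    (n : Finset (HeightOneSpectrum (𝓞 ℚ))) (hn : D.IsLevel n) {j : ℕ} (htj : t + j ≤ k + 1)
    (hPN : ∀ q ∈ n, (Ideal.absNorm q.asIdeal).Coprime N)
    {ψ₀ : (ℓ : ℕ) → (ZMod ℓ)ˣ →* Multiplicative (ZMod (3 ^ j))}
    (hψ₀ : ∀ q ∈ n, Function.Surjective (ψ₀ (Ideal.absNorm q.asIdeal)))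
    (hcert : haveI : NeZero (∏ q ∈ n, Ideal.absNorm q.asIdeal) :=
        ⟨Finset.prod_ne_zero_iff.2 fun q _ => absNorm_ne_zero q⟩
      kuriharaNumber P.f (3 ^ j) (∏ q ∈ n, Ideal.absNorm q.asIdeal) ψ₀ ≠ 0)
    (hv : ∀ c, c ⊂ n → c.Nonempty → ∀ ψ' : (ℓ : ℕ) → (ZMod ℓ)ˣ →* Multiplicative (ZMod (3 ^ j)),
      (∀ q ∈ c, Function.Surjective (ψ' (Ideal.absNorm q.asIdeal))) →
        haveI : NeZero (∏ q ∈ c, Ideal.absNorm q.asIdeal) :=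
          ⟨Finset.prod_ne_zero_iff.2 fun q _ => absNorm_ne_zero q⟩
        kuriharaNumber P.f (3 ^ j) (∏ q ∈ c, Ideal.absNorm q.asIdeal) ψ' = 0) :
    padicValRat 3 (ratPlusSymbol P.f 0) ≤
      (padicValNat 3 (Nat.card (AddCommGroup.primaryComponent W.sha 3)) : ℤ) + ((j - 1 : ℕ) : ℤ) := by
  haveI : Fact (Nat.Prime 3) := ⟨Nat.prime_three⟩
  -- `hR22` at the empty level is the case `d = ∅` of `hR22'`
  have hR22 : ∀ k', (Nat.card ((inv' k').dualSelmerStructure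
          (W.torsionGaloisModule (((3 : ℕ) : ℤ) ^ k' * ((3 : ℕ) : ℤ)))
          (propagatedSelmerStructure W 3 k')).selmerGroup ∣ 3 ^ (k' + 1) →
        addOrderOf (g' k' ∅) * Nat.card ((inv' k').dualSelmerStructure
          (W.torsionGaloisModule (((3 : ℕ) : ℤ) ^ k' * ((3 : ℕ) : ℤ)))
            (propagatedSelmerStructure W 3 k')).selmerGroup = 3 ^ (k' + 1)) ∧
      (3 ^ (k' + 1) ∣ Nat.card ((inv' k').dualSelmerStructure
          (W.torsionGaloisModule (((3 : ℕ) : ℤ) ^ k' * ((3 : ℕ) : ℤ)))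
            (propagatedSelmerStructure W 3 k')).selmerGroup → g' k' ∅ = 0) := by
    intro k'
    have h := hR22' k' ∅ (D' k').isLevel_empty
    have h0 : (D' k').atLevel (propagatedSelmerStructure W 3 k') ∅ =
        propagatedSelmerStructure W 3 k' := SelmerStructure.modify_empty _ _
    rw [h0] at h
    exact h
  -- `hNp`: the dual Selmer group of `𝓕_can` is a finite `3`-group
  have hNp : ∀ k', ∃ l, Nat.card ((inv' k').dualSelmerStructure
      (W.torsionGaloisModule (((3 : ℕ) : ℤ) ^ k' * ((3 : ℕ) : ℤ)))
        (propagatedSelmerStructure W 3 k')).selmerGroup = 3 ^ l := by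
    intro k'
    haveI := hfinT k'
    haveI := hfinS k'
    haveI : NeZero (3 ^ (k' + 1)) := ⟨pow_ne_zero _ three_ne_zero⟩
    have hKSD := DeepLedger.natCard_selmerGroup_kummer_eq_dual_of_eq W
      (((3 : ℕ) : ℤ) ^ k' * ((3 : ℕ) : ℤ)) (3 ^ (k' + 1)) (by push_cast; ring)
      (Nat.prime_three.isPrimePow.pow (Nat.succ_ne_zero k')) ((by decide : Odd 3).pow)
      (inv' k') (hinj' k') hEP
    have hfinKd : Finite ((inv' k').dualSelmerStructure
        (W.torsionGaloisModule (((3 : ℕ) : ℤ) ^ k' * ((3 : ℕ) : ℤ)))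
        (W.kummerSelmerStructure (((3 : ℕ) : ℤ) ^ k' * ((3 : ℕ) : ℤ)))).selmerGroup :=
      Nat.finite_of_card_ne_zero (by rw [← hKSD]; exact Nat.card_pos.ne')
    have hsub := (inv' k').selmerGroup_dualSelmerStructure_anti
      (W.torsionGaloisModule (((3 : ℕ) : ℤ) ^ k' * ((3 : ℕ) : ℤ)))
      (𝓕 := W.kummerSelmerStructure (((3 : ℕ) : ℤ) ^ k' * ((3 : ℕ) : ℤ)))
      (𝓖 := propagatedSelmerStructure W 3 k')
      (fun v => kummerSelmerStructure_le_propagatedSelmerStructure W 3 v k')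
    haveI : Finite ((inv' k').dualSelmerStructure
        (W.torsionGaloisModule (((3 : ℕ) : ℤ) ^ k' * ((3 : ℕ) : ℤ)))
        (propagatedSelmerStructure W 3 k')).selmerGroup :=
      Finite.of_injective (AddSubgroup.inclusion hsub) (AddSubgroup.inclusion_injective hsub)
    exact Transport.exists_natCard_eq_pow_of_nsmul_eq_zero (p := 3) (K := k' + 1) fun x =>
      Subtype.ext (by
        rw [AddSubmonoidClass.coe_nsmul, ZeroMemClass.coe_zero]
        exact galoisCohomology.nsmul_eq_zero_of_forall _
          (fun f => DiscreteGaloisModule.TateDual.nsmul_eq_zero f) x.1)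
  -- `htr`: p11's scalar transport, its pair counts supplied by the level counts at the two depths
  have htr : ∀ k', k ≤ k' → ∀ (κ' : Finset (HeightOneSpectrum (𝓞 ℚ)) →
        galoisCohomology (W.torsionGaloisModule (((3 : ℕ) : ℤ) ^ k * ((3 : ℕ) : ℤ))) 1)
      (κu' : Finset (HeightOneSpectrum (𝓞 ℚ)) →
        galoisCohomology (W.torsionGaloisModule (((3 : ℕ) : ℤ) ^ k' * ((3 : ℕ) : ℤ))) 1)
      (a a' : ℕ), κ' ∈ D.kolyvaginSystems (propagatedSelmerStructure W 3 k) →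
        κu' ∈ (D' k').kolyvaginSystems (propagatedSelmerStructure W 3 k') →
        κ' = a • g → κu' = a' • g' k' →
        (∀ d, (D' k').IsLevel d → D.IsLevel d → galoisCohomology.map (red k') 1 (κu' d) = κ' d) →
        ∀ s, s ≤ k + 1 → (3 ^ s ∣ a ↔ 3 ^ s ∣ a') := by
    intro k' hk' κ' κu' a a' _ _ hκ' hκu' hcomp
    haveI := hfinT k
    haveI := hfinT k'
    haveI := hfinS k
    haveI := hfinS k'
    -- the `Λ`-clauses at the two depths, from the two-level dictionary
    obtain ⟨κ₀, Λ, κ₀', κu₀, Λu, κu₀', hWk, hWk', -⟩ := hdict k' hk'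
    obtain ⟨-, -, hon, hker, -⟩ := hWk
    obtain ⟨-, -, hon', hker', -⟩ := hWk'
    have hPT : ∀ d, D.IsLevel d →
        Nat.card (D.atLevel (propagatedSelmerStructure W 3 k) d).selmerGroup =
          3 ^ (k + 1) * Nat.card ((inv' k).dualSelmerStructure _
            (D.atLevel (propagatedSelmerStructure W 3 k) d)).selmerGroup := fun d hd =>
      DeepLedger.natCard_selmerGroup_propagated_atLevel_eq W 3 k (by norm_num) hv₃ Λ hon hker
        (inv' k) (hperf' k) (hsum' k) (hcompl' k) (hinj' k) hEP (T k) (hv₃T k) (hT k) (h𝓕T k)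
        (h𝓚T k) D hPS hUT hd
    have hPT' : ∀ d, (D' k').IsLevel d →
        Nat.card ((D' k').atLevel (propagatedSelmerStructure W 3 k') d).selmerGroup =
          3 ^ (k' + 1) * Nat.card ((inv' k').dualSelmerStructure _
            ((D' k').atLevel (propagatedSelmerStructure W 3 k') d)).selmerGroup := fun d hd =>
      DeepLedger.natCard_selmerGroup_propagated_atLevel_eq W 3 k' (by norm_num) hv₃ Λu hon' hker'
        (inv' k') (hperf' k') (hsum' k') (hcompl' k') (hinj' k') hEP (T k') (hv₃T k') (hT k')
        (h𝓕T k') (h𝓚T k') (D' k') (hPS' k') (hUT' k') hd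
    exact Transport.pow_dvd_iff_of_comp W hk' D (D' k') (red k') (hred k') hsurj hDT (hDT' k')
      (hPP' k' hk') (inv' k) (inv' k') hg (hg' k') (hgo' k') hR22D (hR22' k') hPT hPT' hκ' hκu' hcomp
  exact padicValRat_ratPlusSymbol_le_of_certificate_twoExp_unlocked W t e k D v₃ hv₃ hsurj P h0 g hgen D' red
    hdict g' hg' hgen' inv' hperf' hsum' hcompl' hinj' hEP T hv₃T hT h𝓕T h𝓚T hfinT hfinS hR22
    hNp htr n hn htj hPN hψ₀ hcert hv

end Summit.BirchSwinnertonDyer.BirchSwinnertonDyer.Theorems.KimAtThreeShallowEqDeepUnlockedEnd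

end
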